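import Mathlib
import HarnessLib
import Summits.Ventures.LatticeQCDFlow.Scaling.AutoregressiveGaugeHeatBathExactFloor
import Summits.Ventures.LatticeQCDFlow.Scaling.AutoregressiveGaugeUniformRateExact
import Summits.Ventures.LatticeQCDFlow.Scaling.AutoregressiveGaugeHeatBathFrozenEvent

/-!
# LatticeQCDFlow / Scaling — the relaxation scale of the exact one-plaquette heat-bath sampler is `c^{#B} M^k/Z`,
# two-sided: rare frozen events with the exact constant against the sharp Doeblin ceiling

HONEST FRAMING: exact (Metropolis-corrected) sampling algorithms for lattice gauge theory;
figures of merit are autocorrelation/cost numbers at stated couplings and volumes; no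
continuum-physics claim.

Venture `LatticeQCDFlow` (cell pub-lqcd), topic `Scaling`, FANOUT row 30 (lean-1, GEN-28) — OUR WORK on
THEORY-2.md §4 row C5.  `AutoregressiveGaugeHeatBathExactFloor`: every event `A ⊆ {F_R > θM^k}` has
`τ_int(1_A − π(A)) ≥ 1/(π(A) + A(cold)/θ) − 1/2` with the EXACT cold escape probability `A(cold) = Z/(c^{#B} M^k)`;
`AutoregressiveGaugeUniformRateExact`: every bounded centred observable has `τ_int ≤ 1/A(cold) − 1/2`.  Here
the bracket is closed (GEN-26's `…FrozenEvent` construction with the exact constant):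

* **`heatBath_exactFloor_event`** — `L ≥ 2`; `w` continuous, `0 < m ≤ w ≤ M = w(1)`, `Haar{w = M} = 0`;
  `(B, t, rank)` ranked with `k = #Bᶜ ≥ 1`: for every `ε > 0` an event `A` (a neighbourhood `{F_R > θM^k}` of
  the cold configuration) with `0 < π(A) < ε` and `τ_int(1_A − π(A)) ≥ 1/(ε + 2A(cold)) − 1/2`;
* **`heatBath_relaxation_two_sided`** — and for the same event `τ_int(1_A − π(A)) ≤ 1/A(cold) − 1/2`:
  `1/(ε + 2A(cold)) − 1/2 ≤ τ_int ≤ 1/A(cold) − 1/2` — THE SUPREMUM OF `τ_int` OVER EVENTS NEAR THE COLD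
  CONFIGURATION IS THE INVERSE COLD ESCAPE PROBABILITY `c^{#B} M^k/Z` UP TO A FACTOR `2 + ε/A(cold)`.  No closing
  section or map enters: those (GEN-26/27) are upper bounds for `Z` (`Z ≤ η·c^{#B} M^k`), i.e. lower bounds
  `≥ η⁻¹/2` for this scale.

NOT CLAIMED: the size of `Z/(c^{#B} M^k)` itself, nor `τ_int` of smooth observables in stationarity.
No `def`, no `sorry`, nothing cited as a fact beyond the tree.
-/

noncomputable section

namespace Summit.Ventures.LatticeQCDFlow.Theory2.Autoregressive

open MeasureTheory ProbabilityTheory Function Finset Filter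
open scoped ENNReal Topology
open Literature.MathematicalPhysics.QuantumFieldTheory Literature.MathematicalPhysics.QuantumLattice
open Summit.Ventures.LatticeQCDFlow.Exactness Summit.Ventures.LatticeQCDFlow.Scoring

variable {d L : ℕ} [NeZero L] {G : Type*} [Group G] [TopologicalSpace G] [IsTopologicalGroup G]
  [CompactSpace G] [SecondCountableTopology G] [MeasurableSpace G] [BorelSpace G]

/-- **THE FROZEN EVENT WITH THE EXACT CONSTANT.**  `L ≥ 2`; `w` continuous, `0 < m ≤ w ≤ M = w(1)`,
`Haar{w = M} = 0`; `(B, t, rank)` ranked with `k = #Bᶜ ≥ 1`.  For every `ε > 0` there is an event `A` with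
`0 < π(A) < ε` and `τ_int(1_A − π(A)) ≥ 1/(ε + 2·Z/(c^{#B} M^k)) − 1/2`. [ours] -/
theorem heatBath_exactFloor_event (hL : 2 ≤ L) {w : G → ℝ} (hw : Continuous w) {m M : ℝ}
    (hm0 : 0 < m) (hm : ∀ g, m ≤ w g) (hM : ∀ g, w g ≤ M) (hw1 : w 1 = M)
    (hnull : haarProbability G {g | w g = M} = 0)
    (B : Finset (Plaquette d L)) (hB : (Finset.univ \ B).Nonempty) (t : Plaquette d L → Edge d L)
    (ht : ∀ p ∈ B, t p ∈ ({(p.1, p.2.1.1), (p.1.shift p.2.1.1, p.2.1.2),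
        (p.1.shift p.2.1.2, p.2.1.1), (p.1, p.2.1.2)} : Finset (Edge d L)))
    (rank : Plaquette d L → ℕ)
    (hrank : ∀ p ∈ B, ∀ p' ∈ B, p ≠ p' → t p ∈ ({(p'.1, p'.2.1.1), (p'.1.shift p'.2.1.1, p'.2.1.2),
        (p'.1.shift p'.2.1.2, p'.2.1.1), (p'.1, p'.2.1.2)} : Finset (Edge d L)) → rank p < rank p')
    (π q : Measure (GaugeConfig d L G)) [IsProbabilityMeasure π] [IsProbabilityMeasure q]
    (hπ : π = (Measure.pi fun _ : Edge d L => haarProbability G).withDensity fun U =>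
      ENNReal.ofReal ((∏ p : Plaquette d L, w (plaquetteHolonomy U p.1 p.2.1.1 p.2.1.2)) /
        ∫ V, ∏ p : Plaquette d L, w (plaquetteHolonomy V p.1 p.2.1.1 p.2.1.2)
          ∂(Measure.pi fun _ : Edge d L => haarProbability G)))
    (hq : q = (Measure.pi fun _ : Edge d L => haarProbability G).withDensity fun U =>
      ENNReal.ofReal ((∏ p ∈ B, w (plaquetteHolonomy U p.1 p.2.1.1 p.2.1.2)) /
        ∫ V, ∏ p ∈ B, w (plaquetteHolonomy V p.1 p.2.1.1 p.2.1.2)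
          ∂(Measure.pi fun _ : Edge d L => haarProbability G)))
    {ε : ℝ} (hε : 0 < ε) :
    ∃ A : Set (GaugeConfig d L G), MeasurableSet A ∧ 0 < π.real A ∧ π.real A < ε ∧
      1 / (ε + 2 * ((∫ V, ∏ p : Plaquette d L, w (plaquetteHolonomy V p.1 p.2.1.1 p.2.1.2)
            ∂(Measure.pi fun _ : Edge d L => haarProbability G)) /
          ((∫ g, w g ∂(haarProbability G)) ^ B.card * M ^ (Finset.univ \ B).card))) - 1 / 2 ≤
        tauInt (fun n => autocov (indepMH q fun U =>
          ((∫ V, ∏ p : Plaquette d L, w (plaquetteHolonomy V p.1 p.2.1.1 p.2.1.2)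
              ∂(Measure.pi fun _ : Edge d L => haarProbability G)) /
            ((∫ V, ∏ p ∈ B, w (plaquetteHolonomy V p.1 p.2.1.1 p.2.1.2)
              ∂(Measure.pi fun _ : Edge d L => haarProbability G)) *
              ∏ p ∈ Finset.univ \ B, w (plaquetteHolonomy U p.1 p.2.1.1 p.2.1.2)))⁻¹) π
            (fun U => A.indicator (fun _ => (1 : ℝ)) U - π.real A) n /
          autocov (indepMH q fun U =>
          ((∫ V, ∏ p : Plaquette d L, w (plaquetteHolonomy V p.1 p.2.1.1 p.2.1.2)
              ∂(Measure.pi fun _ : Edge d L => haarProbability G)) /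
            ((∫ V, ∏ p ∈ B, w (plaquetteHolonomy V p.1 p.2.1.1 p.2.1.2)
              ∂(Measure.pi fun _ : Edge d L => haarProbability G)) *
              ∏ p ∈ Finset.univ \ B, w (plaquetteHolonomy U p.1 p.2.1.1 p.2.1.2)))⁻¹) π
            (fun U => A.indicator (fun _ => (1 : ℝ)) U - π.real A) 0) := by
  set Haar : Measure (GaugeConfig d L G) := Measure.pi fun _ : Edge d L => haarProbability G with hHaar
  set FT : GaugeConfig d L G → ℝ := fun U => ∏ p : Plaquette d L, w (plaquetteHolonomy U p.1 p.2.1.1 p.2.1.2)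
    with hFT
  set FR : GaugeConfig d L G → ℝ := fun U => ∏ p ∈ Finset.univ \ B, w (plaquetteHolonomy U p.1 p.2.1.1 p.2.1.2)
    with hFR
  set ZT : ℝ := ∫ V, FT V ∂Haar with hZT
  set k : ℕ := (Finset.univ \ B).card with hk
  set Ac : ℝ := ZT / ((∫ g, w g ∂(haarProbability G)) ^ B.card * M ^ k) with hAc
  have hw0 : ∀ g, 0 < w g := fun g => hm0.trans_le (hm g)
  have hMpos : 0 < M := (hw0 1).trans_le (hM 1)
  haveI : IsProbabilityMeasure Haar := by rw [hHaar]; infer_instance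
  have hc : 0 < ∫ g, w g ∂(haarProbability G) := haarProbability_integral_pos_of_continuous_pos hw hw0
  have hFTc : Continuous FT := continuous_prodPlaquetteWeight_anyDim hw Finset.univ
  have hFRc : Continuous FR := continuous_prodPlaquetteWeight_anyDim hw (Finset.univ \ B)
  have hFTpos : ∀ U, 0 < FT U := fun U => prod_pos fun p _ => hw0 _
  have hFRle : ∀ U, FR U ≤ M ^ k := fun U => (pow_le_prodPlaquetteWeight_le_pow_anyDim hm0 hm hM _ U).2
  have hFTi : Integrable FT Haar := by
    refine Integrable.mono' (integrable_const (M ^ (Finset.univ : Finset (Plaquette d L)).card))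
      hFTc.aestronglyMeasurable (ae_of_all _ fun U => ?_)
    rw [Real.norm_eq_abs, abs_of_pos (hFTpos U)]
    exact (pow_le_prodPlaquetteWeight_le_pow_anyDim hm0 hm hM _ U).2
  have hZTpos : 0 < ZT := by
    have h := integral_mono (integrable_const (m ^ (Finset.univ : Finset (Plaquette d L)).card)) hFTi
      fun U => (pow_le_prodPlaquetteWeight_le_pow_anyDim hm0 hm hM _ U).1
    rw [integral_const, smul_eq_mul, probReal_univ, one_mul] at h
    exact lt_of_lt_of_le (pow_pos hm0 _) h
  have hAc0 : 0 ≤ Ac := div_nonneg hZTpos.le (mul_nonneg (pow_nonneg hc.le _) (pow_nonneg hMpos.le _))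
  -- the events `A n = {F_R > (1 − 1/(n+2)) M^k}` decrease to the null set `{F_R = M^k}`
  set θ : ℕ → ℝ := fun n => 1 - 1 / ((n : ℝ) + 2) with hθ
  have hn2 : ∀ n : ℕ, (1 : ℝ) / ((n : ℝ) + 2) ≤ 1 / 2 := fun n =>
    one_div_le_one_div_of_le (by norm_num) (by have := (Nat.cast_nonneg n : (0 : ℝ) ≤ n); linarith)
  have hθpos : ∀ n, 0 < θ n := fun n => by
    have := hn2 n; simp only [hθ]; linarith
  have hθhalf : ∀ n, 1 / 2 ≤ θ n := fun n => by
    have := hn2 n; simp only [hθ]; linarith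
  have hθlt : ∀ n, θ n < 1 := fun n => by
    have : (0 : ℝ) < 1 / ((n : ℝ) + 2) := by positivity
    simp only [hθ]; linarith
  set A : ℕ → Set (GaugeConfig d L G) := fun n => {U | θ n * M ^ k < FR U} with hA
  have hAmeas : ∀ n, MeasurableSet (A n) := fun n => measurableSet_lt measurable_const hFRc.measurable
  have hAopen : ∀ n, IsOpen (A n) := fun n => isOpen_lt continuous_const hFRc
  have hAanti : Antitone A := by
    intro i j hij U hU
    simp only [hA, Set.mem_setOf_eq] at hU ⊢
    have hθij : θ i ≤ θ j := by
      simp only [hθ]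
      have : (1 : ℝ) / ((j : ℝ) + 2) ≤ 1 / ((i : ℝ) + 2) :=
        one_div_le_one_div_of_le (by positivity) (by exact_mod_cast Nat.add_le_add_right hij 2)
      linarith
    exact lt_of_le_of_lt (mul_le_mul_of_nonneg_right hθij (pow_nonneg hMpos.le _)) hU
  have hAinter : ⋂ n, A n ⊆ {U | FR U = M ^ k} := by
    intro U hU
    simp only [Set.mem_iInter, hA, Set.mem_setOf_eq] at hU
    refine le_antisymm (hFRle U) ?_
    by_contra hlt
    push Not at hlt
    have hMk : 0 < M ^ k := pow_pos hMpos _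
    obtain ⟨n, hn⟩ := exists_nat_one_div_lt (div_pos (sub_pos.2 hlt) hMk)
    have h1 : (1 : ℝ) / ((n : ℝ) + 2) ≤ 1 / ((n : ℝ) + 1) :=
      one_div_le_one_div_of_le (by positivity) (by linarith)
    have h2 := hU n
    simp only [hθ] at h2
    have h3 : (1 - 1 / ((n : ℝ) + 2)) * M ^ k ≥ (1 - (M ^ k - FR U) / M ^ k) * M ^ k :=
      mul_le_mul_of_nonneg_right (by linarith) hMk.le
    have h4 : (1 - (M ^ k - FR U) / M ^ k) * M ^ k = FR U := by field_simp; ring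
    linarith
  have hnullT : Haar {U | FR U = M ^ k} = 0 :=
    pi_haar_prodWeight_eq_max_null hL hw.measurable hw0 hM hnull (Finset.univ \ B) hB
  have hπac : π ≪ Haar := by rw [hπ]; exact withDensity_absolutelyContinuous _ _
  have hπlim : π (⋂ n, A n) = 0 := measure_mono_null hAinter (hπac hnullT)
  have htend : Tendsto (fun n => π (A n)) atTop (𝓝 (π (⋂ n, A n))) :=
    tendsto_measure_iInter_atTop (fun n => (hAmeas n).nullMeasurableSet) hAanti ⟨0, measure_ne_top _ _⟩
  rw [hπlim] at htend
  obtain ⟨n, hn⟩ := (htend.eventually (gt_mem_nhds (ENNReal.ofReal_pos.2 hε))).exists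
  have hsmall : π.real (A n) < ε := by
    rw [measureReal_def]
    have := (ENNReal.toReal_lt_toReal (measure_ne_top _ _) ENNReal.ofReal_ne_top).2 hn
    rwa [ENNReal.toReal_ofReal hε.le] at this
  have hcold : (fun _ : Edge d L => (1 : G)) ∈ A n := by
    simp only [hA, Set.mem_setOf_eq, hFR]
    rw [prod_plaquetteWeight_cold, hw1]
    exact mul_lt_of_lt_one_left (pow_pos hMpos _) (hθlt n)
  have hHaarpos : 0 < Haar (A n) := (hAopen n).measure_pos Haar ⟨_, hcold⟩
  have hπpos : 0 < π.real (A n) := by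
    rw [measureReal_def, ENNReal.toReal_pos_iff]
    refine ⟨?_, measure_lt_top _ _⟩
    rw [hπ, withDensity_apply _ (hAmeas n)]
    have hcst : ∀ U, ENNReal.ofReal (m ^ (Finset.univ : Finset (Plaquette d L)).card / ZT) ≤
        ENNReal.ofReal (FT U / ZT) := fun U =>
      ENNReal.ofReal_le_ofReal (div_le_div_of_nonneg_right
        (pow_le_prodPlaquetteWeight_le_pow_anyDim hm0 hm hM _ U).1 hZTpos.le)
    calc (0 : ℝ≥0∞) < ENNReal.ofReal (m ^ (Finset.univ : Finset (Plaquette d L)).card / ZT) * Haar (A n) :=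
          ENNReal.mul_pos (ENNReal.ofReal_pos.2 (div_pos (pow_pos hm0 _) hZTpos)).ne' hHaarpos.ne'
      _ = ∫⁻ _ in A n, ENNReal.ofReal (m ^ (Finset.univ : Finset (Plaquette d L)).card / ZT) ∂Haar := by
          rw [setLIntegral_const]
      _ ≤ ∫⁻ U in A n, ENNReal.ofReal (FT U / ZT) ∂Haar := lintegral_mono fun U => hcst U
  -- the floor at `θ n ≥ 1/2`
  have hfloor := (heatBath_exactFloor (G := G) hL hw hm0 hm hM B t ht rank hrank π q hπ hq).2 (θ n) (hθpos n)
    (A n) (hAmeas n) (fun U hU => hU) hπpos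
  refine ⟨A n, hAmeas n, hπpos, hsmall, le_trans ?_ hfloor⟩
  have hden : π.real (A n) + Ac / θ n ≤ ε + 2 * Ac := by
    have h1 : Ac / θ n ≤ Ac / (1 / 2) := div_le_div_of_nonneg_left hAc0 (by norm_num) (hθhalf n)
    rw [div_div_eq_mul_div, div_one] at h1
    linarith
  have hpos2 : 0 < π.real (A n) + Ac / θ n := add_pos_of_pos_of_nonneg hπpos (div_nonneg hAc0 (hθpos n).le)
  have := one_div_le_one_div_of_le hpos2 hden
  linarith

/-- **THE RELAXATION SCALE OF THE EXACT ONE-PLAQUETTE HEAT-BATH SAMPLER IS `1/A(cold) = c^{#B} M^k/Z`, TWO-SIDED.**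
Same hypotheses.  For every `ε > 0` there is an event `A` with `0 < π(A) < ε` and
`1/(ε + 2A(cold)) − 1/2 ≤ τ_int(1_A − π(A)) ≤ 1/A(cold) − 1/2`, `A(cold) = Z/(c^{#B} M^k)`. [ours] -/
theorem heatBath_relaxation_two_sided (hL : 2 ≤ L) {w : G → ℝ} (hw : Continuous w) {m M : ℝ}
    (hm0 : 0 < m) (hm : ∀ g, m ≤ w g) (hM : ∀ g, w g ≤ M) (hw1 : w 1 = M)
    (hnull : haarProbability G {g | w g = M} = 0)
    (B : Finset (Plaquette d L)) (hB : (Finset.univ \ B).Nonempty) (t : Plaquette d L → Edge d L)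
    (ht : ∀ p ∈ B, t p ∈ ({(p.1, p.2.1.1), (p.1.shift p.2.1.1, p.2.1.2),
        (p.1.shift p.2.1.2, p.2.1.1), (p.1, p.2.1.2)} : Finset (Edge d L)))
    (rank : Plaquette d L → ℕ)
    (hrank : ∀ p ∈ B, ∀ p' ∈ B, p ≠ p' → t p ∈ ({(p'.1, p'.2.1.1), (p'.1.shift p'.2.1.1, p'.2.1.2),
        (p'.1.shift p'.2.1.2, p'.2.1.1), (p'.1, p'.2.1.2)} : Finset (Edge d L)) → rank p < rank p')
    (π q : Measure (GaugeConfig d L G)) [IsProbabilityMeasure π] [IsProbabilityMeasure q]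
    (hπ : π = (Measure.pi fun _ : Edge d L => haarProbability G).withDensity fun U =>
      ENNReal.ofReal ((∏ p : Plaquette d L, w (plaquetteHolonomy U p.1 p.2.1.1 p.2.1.2)) /
        ∫ V, ∏ p : Plaquette d L, w (plaquetteHolonomy V p.1 p.2.1.1 p.2.1.2)
          ∂(Measure.pi fun _ : Edge d L => haarProbability G)))
    (hq : q = (Measure.pi fun _ : Edge d L => haarProbability G).withDensity fun U =>
      ENNReal.ofReal ((∏ p ∈ B, w (plaquetteHolonomy U p.1 p.2.1.1 p.2.1.2)) /
        ∫ V, ∏ p ∈ B, w (plaquetteHolonomy V p.1 p.2.1.1 p.2.1.2)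
          ∂(Measure.pi fun _ : Edge d L => haarProbability G)))
    {ε : ℝ} (hε : 0 < ε) :
    ∃ A : Set (GaugeConfig d L G), MeasurableSet A ∧ 0 < π.real A ∧ π.real A < ε ∧
      1 / (ε + 2 * ((∫ V, ∏ p : Plaquette d L, w (plaquetteHolonomy V p.1 p.2.1.1 p.2.1.2)
            ∂(Measure.pi fun _ : Edge d L => haarProbability G)) /
          ((∫ g, w g ∂(haarProbability G)) ^ B.card * M ^ (Finset.univ \ B).card))) - 1 / 2 ≤
        tauInt (fun n => autocov (indepMH q fun U =>
          ((∫ V, ∏ p : Plaquette d L, w (plaquetteHolonomy V p.1 p.2.1.1 p.2.1.2)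
              ∂(Measure.pi fun _ : Edge d L => haarProbability G)) /
            ((∫ V, ∏ p ∈ B, w (plaquetteHolonomy V p.1 p.2.1.1 p.2.1.2)
              ∂(Measure.pi fun _ : Edge d L => haarProbability G)) *
              ∏ p ∈ Finset.univ \ B, w (plaquetteHolonomy U p.1 p.2.1.1 p.2.1.2)))⁻¹) π
            (fun U => A.indicator (fun _ => (1 : ℝ)) U - π.real A) n /
          autocov (indepMH q fun U =>
          ((∫ V, ∏ p : Plaquette d L, w (plaquetteHolonomy V p.1 p.2.1.1 p.2.1.2)
              ∂(Measure.pi fun _ : Edge d L => haarProbability G)) /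
            ((∫ V, ∏ p ∈ B, w (plaquetteHolonomy V p.1 p.2.1.1 p.2.1.2)
              ∂(Measure.pi fun _ : Edge d L => haarProbability G)) *
              ∏ p ∈ Finset.univ \ B, w (plaquetteHolonomy U p.1 p.2.1.1 p.2.1.2)))⁻¹) π
            (fun U => A.indicator (fun _ => (1 : ℝ)) U - π.real A) 0) ∧
      tauInt (fun n => autocov (indepMH q fun U =>
          ((∫ V, ∏ p : Plaquette d L, w (plaquetteHolonomy V p.1 p.2.1.1 p.2.1.2)
              ∂(Measure.pi fun _ : Edge d L => haarProbability G)) /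
            ((∫ V, ∏ p ∈ B, w (plaquetteHolonomy V p.1 p.2.1.1 p.2.1.2)
              ∂(Measure.pi fun _ : Edge d L => haarProbability G)) *
              ∏ p ∈ Finset.univ \ B, w (plaquetteHolonomy U p.1 p.2.1.1 p.2.1.2)))⁻¹) π
            (fun U => A.indicator (fun _ => (1 : ℝ)) U - π.real A) n /
          autocov (indepMH q fun U =>
          ((∫ V, ∏ p : Plaquette d L, w (plaquetteHolonomy V p.1 p.2.1.1 p.2.1.2)
              ∂(Measure.pi fun _ : Edge d L => haarProbability G)) /
            ((∫ V, ∏ p ∈ B, w (plaquetteHolonomy V p.1 p.2.1.1 p.2.1.2)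
              ∂(Measure.pi fun _ : Edge d L => haarProbability G)) *
              ∏ p ∈ Finset.univ \ B, w (plaquetteHolonomy U p.1 p.2.1.1 p.2.1.2)))⁻¹) π
            (fun U => A.indicator (fun _ => (1 : ℝ)) U - π.real A) 0) ≤
        1 / ((∫ V, ∏ p : Plaquette d L, w (plaquetteHolonomy V p.1 p.2.1.1 p.2.1.2)
            ∂(Measure.pi fun _ : Edge d L => haarProbability G)) /
          ((∫ g, w g ∂(haarProbability G)) ^ B.card * M ^ (Finset.univ \ B).card)) - 1 / 2 := by
  obtain ⟨A, hA, hApos, hsmall, hfloor⟩ := heatBath_exactFloor_event hL hw hm0 hm hM hw1 hnull B hB t ht rank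
    hrank π q hπ hq hε
  have hp1 : π.real A ≤ 1 := measureReal_le_one
  have hgm : Measurable fun U => A.indicator (fun _ => (1 : ℝ)) U - π.real A :=
    (measurable_const.indicator hA).sub measurable_const
  have hgb : ∀ U, |A.indicator (fun _ => (1 : ℝ)) U - π.real A| ≤ 1 := by
    intro U
    by_cases hU : U ∈ A
    · simp only [Set.indicator_of_mem hU]
      rw [abs_le]; constructor <;> linarith [hApos.le, hp1]
    · simp only [Set.indicator_of_notMem hU]
      rw [abs_le]; constructor <;> linarith [hApos.le, hp1]
  have hg0 : ∫ U, (A.indicator (fun _ => (1 : ℝ)) U - π.real A) ∂π = 0 := by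
    rw [integral_sub ((integrable_const _).indicator hA) (integrable_const _),
      integral_indicator_const (1 : ℝ) hA, integral_const, smul_eq_mul, smul_eq_mul, mul_one,
      probReal_univ, one_mul, sub_self]
  have hceil := (heatBath_autocorrelation_sharp hL hw hm0 hm hM hw1 B t ht rank hrank π q hπ hq hgm hgb hg0).2
  refine ⟨A, hA, hApos, hsmall, hfloor, ?_⟩
  rw [one_div_div]
  exact hceil

end Summit.Ventures.LatticeQCDFlow.Theory2.Autoregressive

end
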